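import Mathlib
import Summits.Ventures.HodgeRepro2.T6NAut
import Summits.Ventures.HodgeRepro2.T6Composition
import Summits.Ventures.HodgeRepro2.T6InterfaceToy
import Summits.Ventures.HodgeRepro2.T6N3Toy
import Summits.Ventures.HodgeRepro2.T6N42Toy
import Summits.Ventures.HodgeRepro2.T6N5Toy

/-!
# T6NAutToy — a toy `NAut` instance (README §10.5(ii)(c)/(d) for the M2 composition carrier)

Cell pub-hodge-repro2, Tier 6 (README §10), seat t6-lead (gen 2). The referee's open duty on
`T6NAut` (STATUS l. 4997 (1)): a toy `NAut` — every carrier inhabited and every compat field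
discharged on an explicit instance, INCLUDING the richness field `data_surj`, and the binders of
the composition `periodInputN_of_mains` checked on it.

THE TOY. Period datum `toyNDatum F σ₀`: the choices ARE the quadruples of Schwartz data
`ℂ × ℂ × ℂ × ℂ` of the N3 toy (so `data := id` and `data_surj` is immediate), every choice
admissible, the shadow of every choice is the trivial toy shadow of `T6InterfaceToy` (`HS = ℂ`,
`∫_S = 0`), base embedding `σ₀`, generators `0`. Automorphic side: t6-p3's `N3Toy.toy`
(`L²([G]) = ℂ`, Schwartz data `ℂ`, `F φa φb = φa · φb`), t6-p1's toy N1 fields over it (`N1Toy.toyN1`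
re-issued in NAut's parameter shape), t6-p5's `N42Toy.toyFinitePlaces`, t6-p6's `N43Places.toy`, a
constant doubling-L datum over `toyFinitePlaces.Place ⊕ Fin 3` whose finite-place theta Prop IS
`ThetaNonzeroAt` (so `theta_fin` is `Iff.rfl`), t6-p7's `N5Toy.toyData`; the two `hypII_of_N5` fields
are t6-p3's `toy_hypII`.

(c): `nonempty_NAut`. (d): the FIVE AUTOMORPHIC binders of `periodInputN_of_mains` hold jointly on
the toy (`toy_automorphic_binders`: N3 through `toy_N3A` / `toy_N3iso` and
`exists_choice_of_pairing_ne_zero`, N4 through `toy_hypI`, N5 through `toyData_N5`), and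
`(H_loc)` holds on the toy side (`toyNSide_hloc`). The N1 binder
`∀ c, AdmChoice c → pairing c ≠ 0 → I_{τ₁}(D, c) ≠ 0` is NOT joint with them on THIS toy — its
surface side is degenerate (`∫_S = 0`, so `I ≡ 0`, while `pairing (1,1,1,1) = 1 ≠ 0`), and the
composition's conclusion `Hyp.PeriodN` is false on the trivial shadow, consistently. A toy that
also carries N1 needs the non-degenerate surface side of `T6InterfaceToyN` (`HS = HBC K`, with a
non-zero period) TOGETHER WITH the N1 datum's complex conjugation on `HBC K` (the coefficient
conjugation of `ℂ ⊗[ℚ] K` extended to the exterior algebra: an antilinear involutive ring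
endomorphism `conjHBC : HBC K →+* HBC K`) — an N1-owner object (ID-4's `conj` on
`H^*(S_c, ℂ) = H^*(S_c, ℚ) ⊗ ℂ`), requested from t6-p1's successor; `T6NAutToy` v2 then swaps the
shadow for `ToyN.toyN` and adds the N1 binder (`I_ne_zero` from `ToyN.periodN_toyN`).

§8(d): uses an L-value-free non-vanishing device: NO.
-/

namespace Summit.Ventures.HodgeRepro2.T6.NAutToy

open scoped InnerProductSpace

variable {K : Type*} [Field K] [NumberField K]

/-- The toy period datum: the choices are the quadruples of Schwartz data of the N3 toy, all
admissible; every choice carries the trivial toy shadow (`HS = ℂ`, `∫_S = 0`), base embedding `σ₀`,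
generators `0`. -/
noncomputable def toyNDatum (F : FaceSetting K) (σ₀ : K →+* ℂ) : NDatum F where
  Choice := ℂ × ℂ × ℂ × ℂ
  AdmChoice _ := True
  shadow _ := Toy.toyShadow F
  τ₁ := σ₀
  e _ _ := 0
  e_mem _ _ := Submodule.zero_mem _

/-- The toy N1 datum over the N3 toy's `L²([G]) = ℂ` in NAut's parameter shape (t6-p1's
`N1Toy.toyN1` fields: conjugation = complex conjugation on `H^*(S_c, ℂ)`, `H^{1,0} = ⊤`, the zero
dictionary, `c_K = 1`). -/
noncomputable def toyN1 (F : FaceSetting K) (σ₀ : K →+* ℂ) :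
    N1Datum F (toyNDatum F σ₀) N3Toy.toy.LG
      (fun c => N3Toy.toy.A.F c.1 c.2.1) (fun c => N3Toy.toy.B.F c.2.2.1 c.2.2.2) where
  conj _ := starRingEnd ℂ
  conj_smul _ z x := by
    change starRingEnd ℂ (z * (@id ℂ x)) = starRingEnd ℂ z * starRingEnd ℂ (@id ℂ x)
    exact map_mul _ _ _
  conj_conj _ x := Complex.conj_conj (@id ℂ x)
  H10 _ := ⊤
  sc _ := 0
  cK := 1
  cK_pos := one_pos

/-- The toy doubling-L datum over all places of the toy finite-places datum and the three real
places: no bad places, every L-function and local factor `≡ 1`, the finite-place theta Prop IS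
`ThetaNonzeroAt`, the archimedean ones `True`, both auxiliary characters non-trivial. -/
noncomputable def toyD41 : DoublingLDatum (N42Toy.toyFinitePlaces.Place ⊕ Fin 3) where
  S := ∅
  Lv := fun _ _ => 1
  L := fun _ => 1
  thetaNonzero := Sum.elim N42Toy.toyFinitePlaces.ThetaNonzeroAt (fun _ => True)
  L₁ := fun _ => 1
  L₂ := fun _ => 1
  g₁ := fun _ _ => 1
  g₂ := fun _ _ => 1
  triv₁ := False
  triv₂ := False

/-- One toy side of N4. -/
noncomputable def toyNSide : NSide where
  d42 := N42Toy.toyFinitePlaces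
  d43 := N43Places.toy
  d41 := toyD41
  theta_fin _ := Iff.rfl

/-- `(H_loc)` holds on the toy side: the finite half by t6-p5's `N42_main` on the toy, the
archimedean half trivially. -/
theorem toyNSide_hloc : toyNSide.d41.Hloc := by
  rw [NSide.hloc_iff]
  exact ⟨N42Toy.toyFinitePlaces_thetaNonzeroEverywhere, fun _ => trivial⟩

/-- THE TOY `NAut`. -/
noncomputable def toy (F : FaceSetting K) (σ₀ : K →+* ℂ) : NAut F (toyNDatum F σ₀) where
  d3 := N3Toy.toy
  data c := c
  data_surj φa φb φc φd := ⟨(φa, φb, φc, φd), trivial, rfl⟩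
  d1 := toyN1 F σ₀
  sA := toyNSide
  sB := toyNSide
  ι5 := Unit
  G5 := Multiplicative ℤ
  d5 := N5Toy.toyData
  hypII_A_of_N5 _ := N3Toy.toy_hypII
  hypII_B_of_N5 _ := N3Toy.toy_hypII

/-- (c): the carrier is inhabited. -/
theorem nonempty_NAut (F : FaceSetting K) (σ₀ : K →+* ℂ) : Nonempty (NAut F (toyNDatum F σ₀)) :=
  ⟨toy F σ₀⟩

/-- N4's conclusion (Proposition N*'s (i) on both sides) on the toy: t6-p3's `toy_hypI`. -/
theorem toy_N4 (F : FaceSetting K) (σ₀ : K →+* ℂ) : (toy F σ₀).iA ∧ (toy F σ₀).iB :=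
  ⟨N3Toy.toy_hypI, N3Toy.toy_hypI⟩

/-- N5's conclusion on the toy: t6-p7's `toyData_N5`. -/
theorem toy_N5 (F : FaceSetting K) (σ₀ : K →+* ℂ) : (toy F σ₀).N5 := N5Toy.toyData_N5

/-- N3's isotypic step on the toy in the choice form (t6-p3's `toy_N3iso` through
`exists_choice_of_pairing_ne_zero`). -/
theorem toy_N3iso (F : FaceSetting K) (σ₀ : K →+* ℂ) :
    ∃ c, (toyNDatum F σ₀).AdmChoice c ∧ (toy F σ₀).pairing c ≠ 0 :=
  (toy F σ₀).exists_choice_of_pairing_ne_zero N3Toy.toy_N3iso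

/-- (d), automorphic part: the five automorphic binders of `periodInputN_of_mains` (N3A, N3B,
N3iso, N4, N5) hold jointly on the toy. -/
theorem toy_automorphic_binders (F : FaceSetting K) (σ₀ : K →+* ℂ) :
    ((toy F σ₀).iA → (toy F σ₀).iiA → (toy F σ₀).ellA) ∧
    ((toy F σ₀).iB → (toy F σ₀).iiB → (toy F σ₀).ellB) ∧
    ((toy F σ₀).ellA → (toy F σ₀).ellB →
      ∃ c, (toyNDatum F σ₀).AdmChoice c ∧ (toy F σ₀).pairing c ≠ 0) ∧
    ((toy F σ₀).iA ∧ (toy F σ₀).iB) ∧ (toy F σ₀).N5 :=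
  ⟨fun _ _ => N3Toy.toy_N3A, fun _ _ => N3Toy.toy_N3A, fun _ _ => toy_N3iso F σ₀,
    toy_N4 F σ₀, toy_N5 F σ₀⟩

/-- The pairing of the unit quadruple is `1` on the toy (`F φa φb = φa · φb`, `⟪1, 1⟫ = 1`): the
N3iso witness is explicit, and it is why the N1 binder is not joint on the degenerate surface side. -/
theorem toy_pairing_one (F : FaceSetting K) (σ₀ : K →+* ℂ) :
    (toy F σ₀).pairing ((1 : ℂ), (1 : ℂ), (1 : ℂ), (1 : ℂ)) = 1 := by
  show ⟪N3Toy.toy.B.F (1 : ℂ) (1 : ℂ), N3Toy.toy.A.F (1 : ℂ) (1 : ℂ)⟫_ℂ = 1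
  simp [N3Toy.toy, N3Toy.side]

end Summit.Ventures.HodgeRepro2.T6.NAutToy
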